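import Literature.MathematicalPhysics.QuantumLattice.InfVolFermionStateParticleHole
import Literature.MathematicalPhysics.QuantumLattice.SpinSectorPartitionFnParticleHole
import Literature.MathematicalPhysics.QuantumLattice.TorusSectorGibbsMixtureSymmetry
import Literature.MathematicalPhysics.QuantumLattice.HubbardLangerMattisBound
import Literature.MathematicalPhysics.QuantumLattice.TorusSectorGibbsScaleCovariance
import Literature.MathematicalPhysics.QuantumLattice.TorusLimitOfMixtures
import Literature.MathematicalPhysics.QuantumLattice.InfVolFermionStateDensity
import Literature.MathematicalPhysics.QuantumLattice.TransverseWardIdentity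
import Mathlib.Analysis.CStarAlgebra.Matrix
import HarnessLib

/-!
# Thermal torus limits under the particle–hole transformation: the canonical class at density `n` of
# `H(t, t', U)` is carried onto the canonical class at density `2 - n` of `H(t, -t', U)` (even tori)

Family `hubbard` (topic `MathematicalPhysics/QuantumLattice`); seat `hubbard-downfold-unc-2` (cell
`pub/hubbard-downfold`, row «FILLING direction of BOX → WORD», electron-doped half at `T > 0`). Companion of
`InfVolFermionStateParticleHole` (the staggered particle–hole automorphism `α` of the quasi-local CAR algebra
and the transformed state `ω ∘ α = ω.particleHole`), `SpinSectorPartitionFnParticleHole` (the sector map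
`(a, b) ↦ (|Λ| - a, |Λ| - b)` and the compression formula `spinSectorHamiltonian_particleHole_conj`) and of the
thermal CONVENTION OF RECORD of the material-oracle programme: torus limits `ω` of the canonical Gibbs states
of `H_L = hubbardTorusTT' L t t' U` on the sector `(k, k)`, `k = halfRectN n L`
(`IsTorusLimitOfMixture (sectorGibbsCount n) (sectorGibbsWeightTT' β t t' U n) (sectorGibbsVectorTT' t t' U n) Ls`).

* §1 MATRIX LEVEL (any finite orbital set): Gibbs states are invariant under simultaneous reindexing and
  under scalar shifts of the Hamiltonian; the **Gibbs-state transfer**: if `P A Pᴴ = A' - U N + c`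
  (`P = particleHole ε'`, unimodular phases) and `a + a' = b + b' = |Λ|`, then for EVERY matrix `X`
  `gibbsState β (A'|_{(a',b')}) ((P X Pᴴ)|_{(a',b')}) = gibbsState β (A|_{(a,b)}) (X|_{(a,b)})`
  (`gibbsState_spinSectorHamiltonian_particleHole_transfer`) — the canonical state of `A'` on the image
  sector, read on the conjugate of `X`, is the canonical state of `A` on the source sector read on `X`.
* §2 EVEN TORI `(ℤ/Lℤ)²`: the pull-back dictionary `Γ(ι_{Λ,L}) (α_Λ A) = P_L (Γ(ι_{Λ,L}) A) P_Lᴴ`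
  (`fermionEmbed_toTorusEmb_phAut`; the stagger of `ℤ²` descends to the even torus,
  `torusStagger_toTorusEmb`), the translation average of the canonical sector mixture is its plain expectation
  (`sum_sectorGibbsWeightTT'_mul_torusAvgExpectAt_eq`), the bridge between the tree's two sector spellings
  (`gibbsState_sectorHamiltonianTT'_eq_spinSector`), and the FINITE-VOLUME IDENTITY:
  `Σ_i p_i ⟨ψ_i, α(X) ψ_i⟩ = Σ_j p'_j ⟨ψ'_j, X ψ'_j⟩` for every torus matrix `X`, where `(p, ψ)` are the
  canonical data of record of `H_L(t, t', U)` at density `n` and `(p', ψ')` those of `H_L(t, -t', U)` at any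
  density parameter `n'` with complementary sector, `halfRectN n' L + halfRectN n L = L²`
  (`sum_sectorGibbsWeightTT'_mul_expect_phAut_eq`, torus-averaged form
  `sum_sectorGibbsWeightTT'_mul_torusAvgExpectAt_phAut_eq`); the canonical choice `n' = 2 - 2k/L²` always works
  (`halfRectN_two_sub_div_add`), `n' = 2 - n` works iff `nL²/2 ∈ ℤ`.
* §3 THE CLASS STATEMENT: if `ω` is a torus limit of the record class at `(t, t', U, n, β)` along `Ls → ∞`
  with `Ls j` eventually even, then `ω ∘ α` is a torus limit, along the same `Ls`, of the canonical Gibbs states of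
  `H(t, -t', U)` on the reflected sectors (`IsTorusLimitOfMixture.particleHole_of_sectorGibbs`: any complementary
  density parameters `n' L`; `…_canonical`: `n' L = 2 - 2k_L/L²`; `…_of_add`: `n' = 2 - n` when `nL²/2 ∈ ℤ` along
  `Ls` — then the image IS the record class at `(t, -t', U, 2 - n)` and every word stated for that class reads on
  `ω ∘ α`, `IsTorusLimitOfMixture.forall_particleHole_of_sectorGibbs`).

HONEST LIMITS: even tori only (odd tori are not bipartite; the record class quantifies over all `Ls`, so words
obtained through this file bind the sub-class «`Ls` eventually even»); the image sector `(L² - k, L² - k)` is the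
record sector at `2 - n` only when `nL²/2 ∈ ℤ` (else the image is a record-STYLE class with `L`-dependent density
parameters `n' L → 2 - n`); no ensemble-equivalence claim; no number; the mean-energy dictionary is left to a sequel.
Everything is PROVED; no definition, no named fact, no sorry.

## References
* E. H. Lieb, F. Y. Wu, Physica A 321 (2003) 1, §1 eq. (3) (the spin-resolved particle–hole map of the sectors
  with the energy shift `-(N_a - N)U`). [cite: LiebWuPhysicaA2003, §1 eq. (3)]
* H. Tasaki, *Physics and Mathematics of Quantum Many-Body Systems* (2020), §9.3.3. [cite: Tasaki2020, §9.3.3]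
* R. B. Israel, *Convexity in the Theory of Lattice Gases* (1979), §I.3 eq. (26) (the finite-volume Gibbs state
  `tr(e^{-βH}·)/tr e^{-βH}`). [cite: Israel1979, §I.3 eq. (26)]
* O. Bratteli, D. W. Robinson, *OAQSM I* (1987), §4.3.1 (group averages, weak-⋆ limit points); *OAQSM II* (1997),
  §5.2.2 Thm. 5.2.5, §6.2.2. [cite: BratteliRobinsonI1987, §4.3.1 (PDF pp. 373–375)]
* O. Bratteli, A. Kishimoto, D. W. Robinson, CMP 64 (1978) 41, Thm. 2 (mean energy). [cite: BratteliKishimotoRobinson1978, Thm. 2]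

## Mathlib / tree search
REUSED: `phAut`, `phSign_orb`, `siteStagger`, `InfVolFermionState.particleHole(_expect)` (`InfVolFermionStateParticleHole`);
`spinSectorHamiltonian_particleHole_conj`, `spinSectorHamiltonian_sub_smul_totalNumber_add_smul_one`,
`particleHole_hubbardTorusTT'` (via `SpinSectorPartitionFnParticleHole` / `HubbardNNNHoppingParticleHole`);
`fermionEmbed_particleHoleAut`; `sum_sectorGibbsWeightTT'_mul_expect_fockTranslate_mulVec_eq`
(`TorusSectorGibbsMixtureSymmetry`); `sum_sectorGibbsWeightTT'_mul_expect_eq_gibbsState`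
(`TorusSectorGibbsScaleCovariance`); `gibbsState_conj_eq` (`TransverseWardIdentity`); `Matrix.exp_submatrix_equiv`,
`Matrix.trace_submatrix_equiv`, `Matrix.partitionFn_submatrix_equiv` (`HalfFillingGaussianDomination`);
`IsTorusLimitOfMixture.tendsto_meanEnergy_hubbardTTPrime` (`TorusLimitOfMixtures`); `tendsto_rectN_div_sq`
(`InfVolFermionStateDensity`); `torusStagger`, `totalNumber_mulVec_of_isNParticle`, `isNParticle_sectorGibbsVectorTT'`,
`star_sectorGibbsVectorTT'_dotProduct_self`, `sum_sectorGibbsWeightTT'`. `lean search 'IsTorusLimitOfMixture.*particleHole'`: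
nothing before this file.
-/

noncomputable section

namespace Literature.MathematicalPhysics.QuantumLattice

open Matrix Finset HubbardWave0 Literature.Probability.LatticeModels ThermodynamicLimit
open _root_.Filter
open scoped _root_.Topology ComplexOrder BigOperators

/-! ### §1 Matrix level: reindexing, scalar shifts, and the Gibbs-state transfer -/

section MatrixLevel

variable {l m : Type*} [Fintype l] [Fintype m] [DecidableEq l] [DecidableEq m]

/-- **Gibbs states are invariant under simultaneous reindexing** of the Hamiltonian and the observable
along an equivalence. [cite: Israel1979, §I.3 eq. (26)] -/
theorem gibbsState_submatrix_equiv (β : ℝ) (H A : Matrix m m ℂ) (e : l ≃ m) :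
    gibbsState β (H.submatrix e e) (A.submatrix e e) = gibbsState β H A := by
  rw [gibbsState_apply, gibbsState_apply, partitionFn_submatrix_equiv, gibbsWeight, gibbsWeight,
    show -(β : ℂ) • H.submatrix e e = (-(β : ℂ) • H).submatrix e e from rfl, exp_submatrix_equiv,
    submatrix_mul_equiv, trace_submatrix_equiv]

/-- Gibbs states do not depend on the `Fintype` / `DecidableEq` instances used to state them (both are
subsingletons) — the bridge between differently elaborated spellings of the same sector. [cite: Israel1979, §I.3 eq. (26)] -/
theorem gibbsState_congr_inst {n : Type*} (i₁ i₂ : Fintype n) (d₁ d₂ : DecidableEq n) (β : ℝ) (H A : Matrix n n ℂ) :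
    @gibbsState n i₁ d₁ β H A = @gibbsState n i₂ d₂ β H A := by
  cases Subsingleton.elim i₁ i₂
  cases Subsingleton.elim d₁ d₂
  rfl

section Shift

open scoped Matrix.Norms.L2Operator
open NormedSpace

/-- The Gibbs weight of a scalar shift: `e^{-β(H + c)} = e^{-βc} e^{-βH}`. [cite: Israel1979, §I.3 eq. (26)] -/
theorem gibbsWeight_add_smul_one_eq (β : ℝ) (H : Matrix m m ℂ) (c : ℂ) :
    gibbsWeight β (H + c • (1 : Matrix m m ℂ)) = Complex.exp (-(β : ℂ) * c) • gibbsWeight β H := by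
  have hsplit : -(β : ℂ) • (H + c • (1 : Matrix m m ℂ)) = -(β : ℂ) • H + (-(β : ℂ) * c) • (1 : Matrix m m ℂ) := by
    rw [smul_add, smul_smul]
  have hc : Commute (-(β : ℂ) • H) ((-(β : ℂ) * c) • (1 : Matrix m m ℂ)) := (Commute.one_right _).smul_right _
  rw [gibbsWeight, gibbsWeight, hsplit, Matrix.exp_add_of_commute _ _ hc, ← Algebra.algebraMap_eq_smul_one,
    ← algebraMap_exp_comm, ← Complex.exp_eq_exp_ℂ, Algebra.algebraMap_eq_smul_one, Matrix.mul_smul,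
    Matrix.mul_one]

end Shift

/-- **Gibbs states do not see scalar shifts of the Hamiltonian**: `⟨A⟩_{β, H + c} = ⟨A⟩_{β, H}`.
[cite: Israel1979, §I.3 eq. (26)] -/
theorem gibbsState_add_smul_one (β : ℝ) (H A : Matrix m m ℂ) (c : ℂ) :
    gibbsState β (H + c • (1 : Matrix m m ℂ)) A = gibbsState β H A := by
  have hne : Complex.exp (-(β : ℂ) * c) ≠ 0 := Complex.exp_ne_zero _
  rw [gibbsState_apply, gibbsState_apply, partitionFn, partitionFn, gibbsWeight_add_smul_one_eq, Matrix.smul_mul,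
    trace_smul, trace_smul, smul_eq_mul, smul_eq_mul, mul_inv, mul_mul_mul_comm, inv_mul_cancel₀ hne, one_mul]

/-- Conjugation by a diagonal matrix of unimodular phases leaves Gibbs states invariant:
`⟨D X Dᴴ⟩_{β, D H Dᴴ} = ⟨X⟩_{β,H}`. [cite: BratteliRobinsonII1997, §5.2.2, Thm. 5.2.5] -/
theorem gibbsState_diagonal_conj_unimodular (β : ℝ) (H X : Matrix m m ℂ) {d : m → ℂ}
    (hd : ∀ i, d i * star (d i) = 1) :
    gibbsState β (diagonal d * H * diagonal (fun i => star (d i))) (diagonal d * X * diagonal (fun i => star (d i))) =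
      gibbsState β H X := by
  have hinv' : diagonal d * diagonal (fun i => star (d i)) = 1 := by
    rw [diagonal_mul_diagonal, ← diagonal_one]
    congr 1; funext i; exact hd i
  have hinv'' : diagonal (fun i => star (d i)) * diagonal d = 1 := by
    rw [diagonal_mul_diagonal, ← diagonal_one]
    congr 1; funext i; rw [mul_comm]; exact hd i
  have hU : IsUnit (diagonal d) := ⟨⟨diagonal d, diagonal (fun i => star (d i)), hinv', hinv''⟩, rfl⟩
  have hinv : (diagonal d)⁻¹ = diagonal (fun i => star (d i)) := Matrix.inv_eq_right_inv hinv'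
  rw [← hinv]
  exact gibbsState_conj_eq β hU H X

variable {Λ : Type*} [LinearOrder Λ] [Fintype Λ]

/-- **The Gibbs-state transfer under the particle–hole unitary.** If `P A Pᴴ = A' - U N + c · 1` (unimodular
phases) and `a + a' = b + b' = |Λ|`, then for every matrix `X`:
`⟨(P X Pᴴ)|_{(a',b')}⟩_{β, A'|_{(a',b')}} = ⟨X|_{(a,b)}⟩_{β, A|_{(a,b)}}` — the canonical Gibbs state of `A'` on the
image sector, evaluated on the conjugate observable, is the canonical Gibbs state of `A` on the source sector
(the compressions are unitarily conjugate up to the scalar `c - U(a' + b')`, which the Gibbs state does not see).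
[cite: LiebWuPhysicaA2003, §1 eq. (3)] -/
theorem gibbsState_spinSectorHamiltonian_particleHole_transfer (ε : Orb Λ → ℂ) (hε : ∀ i, ‖ε i‖ = 1)
    {A A' : Matrix (Finset (Orb Λ)) (Finset (Orb Λ)) ℂ} {U c : ℝ}
    (hconj : particleHole ε * A * (particleHole ε)ᴴ =
      A' - (U : ℂ) • totalNumber + (c : ℂ) • (1 : Matrix (Finset (Orb Λ)) (Finset (Orb Λ)) ℂ))
    {a b a' b' : ℕ} (ha : a + a' = Fintype.card Λ) (hb : b + b' = Fintype.card Λ) (β : ℝ)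
    (X : Matrix (Finset (Orb Λ)) (Finset (Orb Λ)) ℂ) :
    gibbsState β (spinSectorHamiltonian a' b' A')
        (spinSectorHamiltonian a' b' (particleHole ε * X * (particleHole ε)ᴴ)) =
      gibbsState β (spinSectorHamiltonian a b A) (spinSectorHamiltonian a b X) := by
  -- `A'|_{(a',b')} = (P A Pᴴ)|_{(a',b')} + k·1`
  have hA' : spinSectorHamiltonian a' b' A' =
      spinSectorHamiltonian a' b' (particleHole ε * A * (particleHole ε)ᴴ) +
        (-((c : ℂ) - U * ((a' : ℂ) + b'))) • (1 : Matrix (Subtype (spinConfig (Λ := Λ) a' b'))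
          (Subtype (spinConfig (Λ := Λ) a' b')) ℂ) := by
    rw [hconj, spinSectorHamiltonian_sub_smul_totalNumber_add_smul_one, add_assoc, ← add_smul, add_neg_cancel,
      zero_smul, add_zero]
  rw [hA', gibbsState_add_smul_one, spinSectorHamiltonian_particleHole_conj ε ha hb A,
    spinSectorHamiltonian_particleHole_conj ε ha hb X]
  -- reindex along `s ↦ sᶜ` and undo the diagonal conjugation
  let e : Subtype (spinConfig (Λ := Λ) a' b') ≃ Subtype (spinConfig (Λ := Λ) a b) :=
    { toFun := fun s =>
        ⟨s.1ᶜ, (spinConfig_compl_iff ((Nat.add_comm a' a).trans ha) ((Nat.add_comm b' b).trans hb) s.1).2 s.2⟩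
      invFun := fun s => ⟨s.1ᶜ, (spinConfig_compl_iff ha hb s.1).2 s.2⟩
      left_inv := fun s => Subtype.ext (compl_compl s.1)
      right_inv := fun s => Subtype.ext (compl_compl s.1) }
  have h := gibbsState_submatrix_equiv β
    (diagonal (fun s : Subtype (spinConfig (Λ := Λ) a b) => ∏ i ∈ s.1, star (ε i) * jwSign i univ) *
      spinSectorHamiltonian a b A *
      diagonal (fun s : Subtype (spinConfig (Λ := Λ) a b) => star (∏ i ∈ s.1, star (ε i) * jwSign i univ)))
    (diagonal (fun s : Subtype (spinConfig (Λ := Λ) a b) => ∏ i ∈ s.1, star (ε i) * jwSign i univ) *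
      spinSectorHamiltonian a b X *
      diagonal (fun s : Subtype (spinConfig (Λ := Λ) a b) => star (∏ i ∈ s.1, star (ε i) * jwSign i univ))) e
  rw [gibbsState_diagonal_conj_unimodular β _ _ (fun s => particleHoleWeight_mul_star ε hε s.1)] at h
  exact h

end MatrixLevel

/-! ### §2 Even tori: pull-back dictionary, dropped averages, and the finite-volume identity -/

section Torus

variable {L : ℕ}

/-- The particle–hole phases of the torus are unimodular. [folklore] -/
private theorem norm_torusPhase (i : Orb (FermionTorus 2 L)) : ‖((torusStagger (ofLex i).1 : ℤ) : ℂ)‖ = 1 :=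
  norm_intCast_units _

/-- **The stagger of `ℤ²` descends to the even torus**: for `L` even and a region `Λ` fitting into the torus,
the torus stagger of the pulled-back site `x mod L` is `ε_x` (`Σᵢ (xᵢ mod L) ≡ Σᵢ xᵢ (mod 2)`).
[cite: LiebPRL1989, Theorem 2 (bipartite lattice)] -/
theorem torusStagger_toTorusEmb [NeZero L] (hL : Even L) {Λ : Finset (Site 2)}
    (h : Set.InjOn (Torus.proj (d := 2) L) ↑Λ) (y : PolySite Λ) :
    torusStagger (PolySite.toTorusEmb L h y) = siteStagger (ofLex y.1) := by
  set z := PolySite.toTorusEmb L h y with hz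
  have hcoord : ∀ i, ((ofLex z i : ℕ) : ℤ) = (ofLex y.1) i % L := fun i => by
    rw [hz, PolySite.toTorusEmb_apply, FermionTorus.ofLex_ofTorusSite_apply]
    exact ZMod.val_intCast _
  have heven : Even ((∑ i, ((ofLex z i : ℕ) : ℤ)) - ∑ i, (ofLex y.1) i) := by
    rw [← Finset.sum_sub_distrib]
    refine Finset.even_sum _ fun i _ => ?_
    rw [hcoord i, Int.emod_def]
    obtain ⟨k, hk⟩ := hL
    exact ⟨-((k : ℤ) * ((ofLex y.1) i / L)), by rw [hk]; push_cast; ring⟩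
  rw [torusStagger_apply, siteStagger]
  by_cases hpar : Even (∑ i, (ofLex y.1) i)
  · have h1 : Even (∑ i, (ofLex z i : ℕ)) := by
      have : Even (∑ i, ((ofLex z i : ℕ) : ℤ)) := (Int.even_sub.1 heven).2 hpar
      rw [← Nat.cast_sum] at this
      exact (Int.even_coe_nat _).1 this
    rw [Int.negOnePow_even _ hpar]
    exact (neg_one_pow_eq_one_iff_even (by decide : (-1 : ℤˣ) ≠ 1)).2 h1
  · have h1 : Odd (∑ i, (ofLex z i : ℕ)) := by
      rw [← Nat.not_even_iff_odd]
      intro hev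
      apply hpar
      have : Even (∑ i, ((ofLex z i : ℕ) : ℤ)) := by rw [← Nat.cast_sum]; exact (Int.even_coe_nat _).2 hev
      exact (Int.even_sub.1 heven).1 this
    rw [Int.negOnePow_odd _ (Int.not_even_iff_odd.1 hpar)]
    exact h1.neg_one_pow

/-- **The pull-back of the particle–hole image of a local observable is the torus particle–hole conjugate of
its pull-back** (`L` even): `Γ(ι_{Λ,L}) (α_Λ A) = P_L (Γ(ι_{Λ,L}) A) P_Lᴴ` — both composites are the algebra
homomorphisms `c_{xσ} ↦ ε_x c†_{x mod L, σ}` (`torusStagger_toTorusEmb`). [cite: Tasaki2020, §9.3.3] -/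
theorem fermionEmbed_toTorusEmb_phAut [NeZero L] (hL : Even L) {Λ : Finset (Site 2)}
    (h : Set.InjOn (Torus.proj (d := 2) L) ↑Λ) (A : FermionOp Λ) :
    fermionEmbed (PolySite.toTorusEmb L h) (phAut Λ A) =
      particleHoleAut (fun i : Orb (FermionTorus 2 L) => torusStagger (ofLex i).1)
        (fermionEmbed (PolySite.toTorusEmb L h) A) :=
  fermionEmbed_particleHoleAut (PolySite.toTorusEmb L h) (phSign Λ) (fun i => torusStagger (ofLex i).1)
    (fun i => torusStagger_toTorusEmb hL h (ofLex i).1) A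

/-- `⟨U_u φ, B U_u φ⟩ = ⟨φ, (U_uᴴ B U_u) φ⟩`. [folklore] -/
private theorem expect_fockTranslate_mulVec [NeZero L] (u : TorusSite 2 L)
    (B : Matrix (Finset (Orb (FermionTorus 2 L))) (Finset (Orb (FermionTorus 2 L))) ℂ)
    (φ : Fock (Orb (FermionTorus 2 L))) :
    expect B ((fockTranslate u).val *ᵥ φ) = expect ((fockTranslate u).valᴴ * B * (fockTranslate u).val) φ := by
  rw [expect, expect, star_mulVec_dotProduct_mulVec_mulVec (fockTranslate u).val B]

/-- **The translation average of the canonical sector mixture is its plain expectation** (the canonical Gibbs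
state of the torus is translation invariant): for `Λ` fitting into the torus and `A ∈ 𝔄_Λ`,
`Σ_i p_i · torusAvgExpectAt L Λ A ψ_i = Σ_i p_i ⟨ψ_i, Γ(ι_{Λ,L}) A ψ_i⟩`, at any density parameter.
[cite: Israel1979, §I.3 eq. (26)] -/
theorem sum_sectorGibbsWeightTT'_mul_torusAvgExpectAt_eq [NeZero L] (β t t' U n : ℝ) {Λ : Finset (Site 2)}
    (hInj : Set.InjOn (Torus.proj (d := 2) L) ↑Λ) (A : FermionOp Λ) :
    ∑ i, (sectorGibbsWeightTT' β t t' U n L i : ℂ) * torusAvgExpectAt L Λ A (sectorGibbsVectorTT' t t' U n L i) =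
      ∑ i, (sectorGibbsWeightTT' β t t' U n L i : ℂ) *
        expect (fermionEmbed (PolySite.toTorusEmb L hInj) A) (sectorGibbsVectorTT' t t' U n L i) := by
  set B := fermionEmbed (PolySite.toTorusEmb L hInj) A with hB
  have hcard : ((Fintype.card (TorusSite 2 L) : ℂ)) ≠ 0 := by
    exact_mod_cast (Fintype.card_pos (α := TorusSite 2 L)).ne'
  calc ∑ i, (sectorGibbsWeightTT' β t t' U n L i : ℂ) * torusAvgExpectAt L Λ A (sectorGibbsVectorTT' t t' U n L i)
      = ((Fintype.card (TorusSite 2 L) : ℂ))⁻¹ * ∑ u : TorusSite 2 L, ∑ i,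
          (sectorGibbsWeightTT' β t t' U n L i : ℂ) *
            expect B ((fockTranslate u).val *ᵥ sectorGibbsVectorTT' t t' U n L i) := by
        rw [Finset.sum_comm, Finset.mul_sum]
        refine Finset.sum_congr rfl fun i _ => ?_
        rw [torusAvgExpectAt_of_injOn L hInj, Finset.mul_sum, Finset.mul_sum, Finset.mul_sum]
        refine Finset.sum_congr rfl fun u _ => ?_
        rw [mul_left_comm]
    _ = ((Fintype.card (TorusSite 2 L) : ℂ))⁻¹ * ∑ _u : TorusSite 2 L, ∑ i,
          (sectorGibbsWeightTT' β t t' U n L i : ℂ) * expect B (sectorGibbsVectorTT' t t' U n L i) := by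
        refine congrArg (fun z => ((Fintype.card (TorusSite 2 L) : ℂ))⁻¹ * z) (Finset.sum_congr rfl fun u _ => ?_)
        exact sum_sectorGibbsWeightTT'_mul_expect_fockTranslate_mulVec_eq L t t' U n β u B
    _ = ∑ i, (sectorGibbsWeightTT' β t t' U n L i : ℂ) * expect B (sectorGibbsVectorTT' t t' U n L i) := by
        rw [Finset.sum_const, Finset.card_univ, nsmul_eq_mul, ← mul_assoc, inv_mul_cancel₀ hcard, one_mul]

/-- **Bridge between the two sector spellings of the tree** (`sectorHamiltonianTT' t t' U n L` over
`Subtype (szConfig n L)` and `spinSectorHamiltonian k k (hubbardTorusTT' L t t' U)` over `Subtype (spinConfig k k)`,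
`k = halfRectN n L` — the same matrices, stated with different decidability instances): their Gibbs states agree
on compressions. [cite: Israel1979, §I.3 eq. (26)] -/
theorem gibbsState_sectorHamiltonianTT'_eq_spinSector (β t t' U n : ℝ) (L : ℕ)
    (Y : Matrix (Finset (Orb (FermionTorus 2 L))) (Finset (Orb (FermionTorus 2 L))) ℂ) :
    gibbsState β (sectorHamiltonianTT' t t' U n L) (Y.submatrix Subtype.val Subtype.val) =
      gibbsState β (spinSectorHamiltonian (halfRectN n L) (halfRectN n L) (hubbardTorusTT' L t t' U))
        (spinSectorHamiltonian (halfRectN n L) (halfRectN n L) Y) :=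
  gibbsState_congr_inst _ _ _ _ β _ _

/-- `|(ℤ/Lℤ)²| = L²` (in this file's instance context). [folklore] -/
private theorem card_fermionTorus_two' (L : ℕ) : Fintype.card (FermionTorus 2 L) = L ^ 2 := by
  simp [FermionTorus, Fintype.card_lex]

/-- The torus conjugation identity `P H_L(t, -t', U) Pᴴ = H_L(t, t', U) - U N + U L²` (`L` even), restated from
`particleHole_hubbardTorusTT'` in the instance context of this file. [cite: EsslerEtAl2005, §2.2.4 eqs. (2.59)–(2.61)] -/
private theorem particleHole_hubbardTorusTT'_neg (hL : Even L) (t t' U : ℝ) :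
    particleHole (fun i : Orb (FermionTorus 2 L) => ((torusStagger (ofLex i).1 : ℤ) : ℂ)) *
        hubbardTorusTT' L t (-t') U *
        (particleHole (fun i : Orb (FermionTorus 2 L) => ((torusStagger (ofLex i).1 : ℤ) : ℂ)))ᴴ =
      hubbardTorusTT' L t t' U - (U : ℂ) • totalNumber +
        ((U * L ^ 2 : ℝ) : ℂ) • (1 : Matrix (Finset (Orb (FermionTorus 2 L))) (Finset (Orb (FermionTorus 2 L))) ℂ) := by
  have h := particleHole_hubbardTorusTT' hL t (-t') U
  rw [neg_neg] at h
  convert h using 4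

/-- **THE FINITE-VOLUME IDENTITY.** `L` even; two density parameters `n, n'` whose sectors of record are
complementary, `halfRectN n' L + halfRectN n L = L²` (e.g. `n' = 2 - 2·halfRectN n L/L²`, or `n' = 2 - n` when
`nL²/2 ∈ ℤ`). With `(p, ψ)` the canonical data of `H_L(t, t', U)` at `n` and `(p', ψ')` those of `H_L(t, -t', U)` at
`n'`: for EVERY torus matrix `X`, `Σ_i p_i ⟨ψ_i, P_L X P_Lᴴ ψ_i⟩ = Σ_j p'_j ⟨ψ'_j, X ψ'_j⟩`.
[cite: LiebWuPhysicaA2003, §1 eq. (3)] -/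
theorem sum_sectorGibbsWeightTT'_mul_expect_phAut_eq (hL : Even L) (β t t' U : ℝ) {n n' : ℝ}
    (hk : halfRectN n' L + halfRectN n L = L ^ 2)
    (X : Matrix (Finset (Orb (FermionTorus 2 L))) (Finset (Orb (FermionTorus 2 L))) ℂ) :
    ∑ i, (sectorGibbsWeightTT' β t t' U n L i : ℂ) *
        expect (particleHoleAut (fun i : Orb (FermionTorus 2 L) => torusStagger (ofLex i).1) X)
          (sectorGibbsVectorTT' t t' U n L i) =
      ∑ j, (sectorGibbsWeightTT' β t (-t') U n' L j : ℂ) * expect X (sectorGibbsVectorTT' t (-t') U n' L j) := by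
  rw [sum_sectorGibbsWeightTT'_mul_expect_eq_gibbsState, sum_sectorGibbsWeightTT'_mul_expect_eq_gibbsState,
    gibbsState_sectorHamiltonianTT'_eq_spinSector, gibbsState_sectorHamiltonianTT'_eq_spinSector, particleHoleAut_apply]
  have hk' : halfRectN n' L + halfRectN n L = Fintype.card (FermionTorus 2 L) := by rw [card_fermionTorus_two']; exact hk
  -- the generic transfer lemma derives its instances from `[LinearOrder] [Fintype]`; the conjugation identity is
  -- handed over through `convert` (decidability instances are subsingletons)
  exact gibbsState_spinSectorHamiltonian_particleHole_transfer
    (fun i : Orb (FermionTorus 2 L) => ((torusStagger (ofLex i).1 : ℤ) : ℂ)) norm_torusPhase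
    (A := hubbardTorusTT' L t (-t') U) (A' := hubbardTorusTT' L t t' U) (U := U) (c := U * L ^ 2)
    (by convert particleHole_hubbardTorusTT'_neg hL t t' U) hk' hk' β X

/-- **Torus-averaged form of the finite-volume identity** (the one the torus-limit predicate uses): for `L`
even, a region `Λ` fitting into the torus and `A ∈ 𝔄_Λ`,
`Σ_i p_i · torusAvgExpectAt L Λ (α_Λ A) ψ_i = Σ_j p'_j · torusAvgExpectAt L Λ A ψ'_j`.
[cite: LiebWuPhysicaA2003, §1 eq. (3)] -/
theorem sum_sectorGibbsWeightTT'_mul_torusAvgExpectAt_phAut_eq [NeZero L] (hL : Even L) (β t t' U : ℝ) {n n' : ℝ}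
    (hk : halfRectN n' L + halfRectN n L = L ^ 2) {Λ : Finset (Site 2)}
    (hInj : Set.InjOn (Torus.proj (d := 2) L) ↑Λ) (A : FermionOp Λ) :
    ∑ i, (sectorGibbsWeightTT' β t t' U n L i : ℂ) * torusAvgExpectAt L Λ (phAut Λ A) (sectorGibbsVectorTT' t t' U n L i) =
      ∑ j, (sectorGibbsWeightTT' β t (-t') U n' L j : ℂ) * torusAvgExpectAt L Λ A (sectorGibbsVectorTT' t (-t') U n' L j) := by
  rw [sum_sectorGibbsWeightTT'_mul_torusAvgExpectAt_eq β t t' U n hInj,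
    sum_sectorGibbsWeightTT'_mul_torusAvgExpectAt_eq β t (-t') U n' hInj, fermionEmbed_toTorusEmb_phAut hL hInj]
  exact sum_sectorGibbsWeightTT'_mul_expect_phAut_eq hL β t t' U hk _

/-- **The canonical choice of the image density**: `n' = 2 - 2k/L²`, `k = halfRectN n L`, has sector of record
`L² - k` (`L ≥ 1`, `0 ≤ n ≤ 2`). [cite: LiebWuPhysicaA2003, §1 eq. (3)] -/
theorem halfRectN_two_sub_div {n : ℝ} (hn0 : 0 ≤ n) (hn2 : n ≤ 2) {L : ℕ} (hL : 1 ≤ L) :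
    halfRectN (2 - 2 * (halfRectN n L : ℝ) / (L : ℝ) ^ 2) L = L ^ 2 - halfRectN n L := by
  have hk : halfRectN n L ≤ L ^ 2 := by
    have h := ThermodynamicLimit.rectN_le_two_mul hn0 hn2 L
    have h2 : rectN n L = 2 * halfRectN n L := rfl
    rw [h2] at h; rw [sq]; omega
  have hL0 : (0 : ℝ) < (L : ℝ) ^ 2 := by positivity
  have key : (2 - 2 * (halfRectN n L : ℝ) / (L : ℝ) ^ 2) * (L : ℝ) ^ 2 / 2 = ((L ^ 2 - halfRectN n L : ℕ) : ℝ) := by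
    rw [Nat.cast_sub hk]
    push_cast
    field_simp
  calc halfRectN (2 - 2 * (halfRectN n L : ℝ) / (L : ℝ) ^ 2) L = ⌊((L ^ 2 - halfRectN n L : ℕ) : ℝ)⌋₊ := by
        show ⌊_⌋₊ = _
        rw [key]
    _ = L ^ 2 - halfRectN n L := Nat.floor_natCast _

/-- Hence `halfRectN n' L + halfRectN n L = L²` for the canonical image density, at every `L ≥ 1`. [cite: LiebWuPhysicaA2003, §1 eq. (3)] -/
theorem halfRectN_two_sub_div_add {n : ℝ} (hn0 : 0 ≤ n) (hn2 : n ≤ 2) {L : ℕ} (hL : 1 ≤ L) :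
    halfRectN (2 - 2 * (halfRectN n L : ℝ) / (L : ℝ) ^ 2) L + halfRectN n L = L ^ 2 := by
  have hk : halfRectN n L ≤ L ^ 2 := by
    have h := ThermodynamicLimit.rectN_le_two_mul hn0 hn2 L
    have h2 : rectN n L = 2 * halfRectN n L := rfl
    rw [h2] at h; rw [sq]; omega
  rw [halfRectN_two_sub_div hn0 hn2 hL]
  omega

end Torus

/-! ### §3 The class statement: torus limits of record at `n` ↦ torus limits of `H(t,-t',U)` at the reflected density -/

namespace InfVolFermionState

/-- **The particle–hole transform of a thermal torus limit of record is a thermal torus limit of the reflected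
model at the reflected densities.** Let `ω` be a torus limit, along `Ls → ∞` with `Ls j` eventually EVEN, of the
canonical Gibbs states of `H_L(t, t', U)` on the sectors of record at density `n`, and let `n' : ℕ → ℝ` be density
parameters with complementary sectors, `halfRectN (n' L) L + halfRectN n L = L²` eventually along `Ls`. Then
`ω ∘ α` is a torus limit, along the same `Ls`, of the canonical Gibbs states of `H_L(t, -t', U)` on the sectors of
record at the densities `n' L` (which tend to `2 - n`). [cite: LiebWuPhysicaA2003, §1 eq. (3)]
[cite: BratteliRobinsonI1987, §4.3.1 (PDF pp. 373–375)] -/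
theorem IsTorusLimitOfMixture.particleHole_of_sectorGibbs (β t t' U n : ℝ) (n' : ℕ → ℝ) {Ls : ℕ → ℕ}
    (hLs : Tendsto Ls atTop atTop) (heven : ∀ᶠ j in atTop, Even (Ls j))
    (hcomp : ∀ᶠ j in atTop, halfRectN (n' (Ls j)) (Ls j) + halfRectN n (Ls j) = Ls j ^ 2) {ω : InfVolFermionState 2}
    (hω : ω.IsTorusLimitOfMixture (sectorGibbsCount n) (fun L => sectorGibbsWeightTT' β t t' U n L)
      (fun L => sectorGibbsVectorTT' t t' U n L) Ls) :
    ω.particleHole.IsTorusLimitOfMixture (fun L => sectorGibbsCount (n' L) L)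
      (fun L => sectorGibbsWeightTT' β t (-t') U (n' L) L) (fun L => sectorGibbsVectorTT' t (-t') U (n' L) L) Ls := by
  intro Λ A
  rw [particleHole_expect]
  refine (hω Λ (phAut Λ A)).congr' ?_
  filter_upwards [eventually_injOn_proj_of_tendsto Λ hLs, hLs.eventually_ge_atTop 1, heven, hcomp]
    with j hInj hj hev hk
  haveI : NeZero (Ls j) := ⟨by omega⟩
  simp_rw [torusAvgExpect_eq]
  exact sum_sectorGibbsWeightTT'_mul_torusAvgExpectAt_phAut_eq hev β t t' U hk hInj A

/-- **Canonical form**: with the image densities `n' L = 2 - 2·halfRectN n L/L²` (`0 ≤ n ≤ 2`), the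
particle–hole transform of every record torus limit at `(t, t', U, n, β)` along eventually-even `Ls → ∞` is a
record-style torus limit of `H(t, -t', U)` at the densities `n' L` (no divisibility hypothesis).
[cite: LiebWuPhysicaA2003, §1 eq. (3)] -/
theorem IsTorusLimitOfMixture.particleHole_of_sectorGibbs_canonical (β t t' U : ℝ) {n : ℝ} (hn0 : 0 ≤ n)
    (hn2 : n ≤ 2) {Ls : ℕ → ℕ} (hLs : Tendsto Ls atTop atTop) (heven : ∀ᶠ j in atTop, Even (Ls j))
    {ω : InfVolFermionState 2}
    (hω : ω.IsTorusLimitOfMixture (sectorGibbsCount n) (fun L => sectorGibbsWeightTT' β t t' U n L)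
      (fun L => sectorGibbsVectorTT' t t' U n L) Ls) :
    ω.particleHole.IsTorusLimitOfMixture
      (fun L => sectorGibbsCount (2 - 2 * (halfRectN n L : ℝ) / (L : ℝ) ^ 2) L)
      (fun L => sectorGibbsWeightTT' β t (-t') U (2 - 2 * (halfRectN n L : ℝ) / (L : ℝ) ^ 2) L)
      (fun L => sectorGibbsVectorTT' t (-t') U (2 - 2 * (halfRectN n L : ℝ) / (L : ℝ) ^ 2) L) Ls :=
  hω.particleHole_of_sectorGibbs β t t' U n (fun L => 2 - 2 * (halfRectN n L : ℝ) / (L : ℝ) ^ 2) hLs heven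
    (by filter_upwards [hLs.eventually_ge_atTop 1] with j hj using halfRectN_two_sub_div_add hn0 hn2 hj)

/-- **Record-to-record form.** When the sectors of record at `n` and `2 - n` are complementary along `Ls`
(`halfRectN (2 - n) L + halfRectN n L = L²`, i.e. `nL²/2 ∈ ℤ` — e.g. `n = 7/8` or `9/8` along `4 ∣ L`), the
particle–hole transform of a record torus limit at `(t, t', U, n, β)` IS a record torus limit at
`(t, -t', U, 2 - n, β)` — every word of the tree stated for the record class at `(t, -t', U, 2 - n)` along such `Ls`
reads on `ω ∘ α`. [cite: LiebWuPhysicaA2003, §1 eq. (3)] -/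
theorem IsTorusLimitOfMixture.particleHole_of_sectorGibbs_of_add (β t t' U n : ℝ) {Ls : ℕ → ℕ}
    (hLs : Tendsto Ls atTop atTop) (heven : ∀ᶠ j in atTop, Even (Ls j))
    (hadd : ∀ᶠ j in atTop, halfRectN (2 - n) (Ls j) + halfRectN n (Ls j) = Ls j ^ 2)
    {ω : InfVolFermionState 2}
    (hω : ω.IsTorusLimitOfMixture (sectorGibbsCount n) (fun L => sectorGibbsWeightTT' β t t' U n L)
      (fun L => sectorGibbsVectorTT' t t' U n L) Ls) :
    ω.particleHole.IsTorusLimitOfMixture (sectorGibbsCount (2 - n))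
      (fun L => sectorGibbsWeightTT' β t (-t') U (2 - n) L) (fun L => sectorGibbsVectorTT' t (-t') U (2 - n) L) Ls :=
  hω.particleHole_of_sectorGibbs β t t' U n (fun _ => 2 - n) hLs heven hadd

/-- **Every word for the reflected class is a word for `ω ∘ α`** (record-to-record case): if a property `P`
holds for every torus limit, along every `Ls' → ∞`, of the record class at `(t, -t', U, 2 - n, β)`, then `P (ω ∘ α)`
for every torus limit `ω` of the record class at `(t, t', U, n, β)` along eventually-even `Ls` with complementary
sectors. [cite: LiebWuPhysicaA2003, §1 eq. (3)] -/
theorem IsTorusLimitOfMixture.forall_particleHole_of_sectorGibbs (β t t' U n : ℝ) {P : InfVolFermionState 2 → Prop}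
    (hP : ∀ (Ls' : ℕ → ℕ) (ω' : InfVolFermionState 2), Tendsto Ls' atTop atTop →
      ω'.IsTorusLimitOfMixture (sectorGibbsCount (2 - n)) (fun L => sectorGibbsWeightTT' β t (-t') U (2 - n) L)
        (fun L => sectorGibbsVectorTT' t (-t') U (2 - n) L) Ls' → P ω')
    {Ls : ℕ → ℕ} (hLs : Tendsto Ls atTop atTop) (heven : ∀ᶠ j in atTop, Even (Ls j))
    (hadd : ∀ᶠ j in atTop, halfRectN (2 - n) (Ls j) + halfRectN n (Ls j) = Ls j ^ 2)
    {ω : InfVolFermionState 2}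
    (hω : ω.IsTorusLimitOfMixture (sectorGibbsCount n) (fun L => sectorGibbsWeightTT' β t t' U n L)
      (fun L => sectorGibbsVectorTT' t t' U n L) Ls) :
    P ω.particleHole :=
  hP Ls _ hLs (hω.particleHole_of_sectorGibbs_of_add β t t' U n hLs heven hadd)

end InfVolFermionState

end Literature.MathematicalPhysics.QuantumLattice
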